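import Literature.AlgebraicGeometry.Resolution.GRingPolynomialKernelFibre
import Literature.AlgebraicGeometry.Resolution.GRingPolynomialKernelFrobenius
import HarnessLib

/-!
# Discharge of `Stacks07PV` (Grothendieck: `R` a G-ring ⇒ `R[x]` a G-ring) and of `Stacks07QU`
# (finite type algebras over quasi-excellent rings are quasi-excellent)

Topic: `Literature/AlgebraicGeometry/Resolution`. Sibling of `GeneralLU.lean` (which vendors the
named fact `Stacks07QU`; it cannot hold the discharge itself because the G-ring machinery imports
it through `Temkin2008.lean`). The tree reduced both named facts to the kernel `hker`
(`stacks07PV_of_kernel`, `stacks07QU_of_kernel`, `GRingPolynomialCoreReduction.lean`): for a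
complete regular local ring `A`, a prime `𝔯` of `A[x]` with `𝔯 ∩ A = 0` and a prime `𝔫` of
`A[x]/𝔯`, the generic formal fibre of `(A[x]/𝔯)_𝔫` is geometrically regular. The kernel is now
PROVED in all cases:

* `𝔯 ≠ 0`, any characteristic: `hasGeomRegularGenericFormalFibre_polynomial_quotient_of_ne_bot`
  (Stacks 07PU, `GRingPolynomialKernelFibre.lean`);
* `𝔯 = 0`, characteristic `0`: `hasGeomRegularGenericFormalFibre_polynomial_quotient_bot_of_charZero`
  (`GRingPolynomialKernelGeneric.lean`);
* `𝔯 = 0`, characteristic `p`: `hasGeomRegularGenericFormalFibre_polynomial_quotient_bot_of_charP`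
  (Stacks 07PR with `m = 1`, `GRingPolynomialKernelFrobenius.lean`).

Stacks, Tag 07PV (Proposition 15.51.10): "Let `R` be a G-ring. If `R → S` is essentially of
finite type then `S` is a G-ring." Tag 07QU (Lemma 15.53.2): "Any localization of a finite type
ring over a (quasi-)excellent ring is (quasi-)excellent." Matsumura, *Commutative Ring Theory*,
p. 261: "Theorem 77 … the proof is very hard" — here it is, assembled from Matsumura §32 and
Stacks 07PN–07PV. Everything is PROVED; no new notions, no named facts.

## Sources

* The Stacks Project, Tags 07PV (Prop. 15.51.10), 07QU (Lemma 15.53.2), 07PU, 07PR, 07PN, 07PT.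
  [StacksProject]
* H. Matsumura, *Commutative Ring Theory*, CUP 1986, §32 pp. 255–261. [Matsumura1987]
-/

noncomputable section

open IsLocalRing Polynomial

namespace Literature.AlgebraicGeometry.Resolution

universe u

/-- **The kernel of Stacks 07PV**: for a complete regular local ring `A`, a prime `𝔯` of `A[x]`
with `𝔯 ∩ A = 0` and a prime `𝔫` of `A[x]/𝔯`, the generic formal fibre of `(A[x]/𝔯)_𝔫` is
geometrically regular (`𝔯 ≠ 0`: Stacks 07PU; `𝔯 = 0`: Stacks 07PR, by the characteristic).
[cite: StacksProject, Tag 07PV (proof)] -/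
theorem hasGeomRegularGenericFormalFibre_polynomial_quotient' (A : Type u) [CommRing A]
    [IsRegularLocalRing A] [IsAdicComplete (maximalIdeal A) A] (r : Ideal A[X]) [r.IsPrime]
    (hrA : r.under A = ⊥) (n : Ideal (A[X] ⧸ r)) [n.IsPrime] :
    HasGeomRegularGenericFormalFibre (A[X] ⧸ r) n := by
  by_cases hr0 : r = ⊥
  · subst hr0
    haveI : IsDomain A := isDomain_of_isRegularLocalRing A
    obtain ⟨p, hp⟩ := CharP.exists A
    rcases CharP.char_is_prime_or_zero A p with hprime | rfl
    · haveI : Fact p.Prime := ⟨hprime⟩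
      exact hasGeomRegularGenericFormalFibre_polynomial_quotient_bot_of_charP A p n
    · haveI : CharZero A := CharP.charP_to_charZero A
      exact hasGeomRegularGenericFormalFibre_polynomial_quotient_bot_of_charZero A n
  · exact hasGeomRegularGenericFormalFibre_polynomial_quotient_of_ne_bot A r hr0 hrA n

/-- **DISCHARGE of the named fact `Stacks07PV`** (`QuasiExcellentFiniteType.lean`; Stacks,
Tag 07PV = Proposition 15.51.10: "Let `R` be a G-ring. If `R → S` is essentially of finite type
then `S` is a G-ring"), by `stacks07PV_of_kernel` and the kernel above.
[cite: StacksProject, Tag 07PV] -/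
theorem Stacks07PV_holds : Stacks07PV.{u} :=
  stacks07PV_of_kernel fun A _ _ _ r _ hrA n _ _ =>
    hasGeomRegularGenericFormalFibre_polynomial_quotient' A r hrA n

/-- **DISCHARGE of the named fact `Stacks07QU`** (`GeneralLU.lean`; Stacks, Tag 07QU =
Lemma 15.53.2: a finite type algebra over a quasi-excellent ring is quasi-excellent — J-2 by
`IsJ2Ring.of_finiteType`, G-ring by Stacks 07PV), by `stacks07QU_of_stacks07PV` and
`Stacks07PV_holds`. [cite: StacksProject, Tag 07QU] -/
theorem Stacks07QU_holds : Stacks07QU.{u} :=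
  stacks07QU_of_stacks07PV Stacks07PV_holds

end Literature.AlgebraicGeometry.Resolution

end
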